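/-
HONEST FRAMING: certified error envelopes and provably optimal rounding/accumulation schemes for
low-precision formats under stated cost models; every table by two implementations; no hardware
or vendor claims.
-/
import Summits.Ventures.CertifiedArithmetic.LowPrec.OptDemotionRoutingConeQ4CertA
import Summits.Ventures.CertifiedArithmetic.LowPrec.OptDemotionRoutingConeQ4CertB
import Summits.Ventures.CertifiedArithmetic.LowPrec.OptDemotionRoutingConeQ4CertC

/-!
# The demotion law (Theorem T8), part 9f (Q4): `TT 4` AND CONJECTURE D FOR EVERY TREE AT q = 4

Assembly of the kernel-checked cone-closure certificate at `q = 4` (opt gen 14 C36,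
`certs/opt/closure_q4.json`; parts 9a–9e): every row of `coneRowsQ4` has a passing certificate tree
(`coneRowsQ4_covered`), so by the cone-closure principle (part 9c) the routing table of EVERY
summation tree lies in the cone (`tab_inCone_q4`), whose `O`/`E` rows give opt's two-tree
inequality **`TT 4`** (`TT_four`; part 8l — until now certified numerically, C33), hence by
part 8n `conjectureD_of_TT` **CONJECTURE D `s ≤ Q_t · fl_p(ŝ)` FOR EVERY SUMMATION TREE at
precision q = 4**, every `p ≥ 1`, any nearest roundings, nonnegative data (`conjectureD_q4`), and
the routing conjecture `W = BR` for every shape at `q = 4` (`routingBound_q4`).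
-/

namespace Summit.Ventures.CertifiedArithmetic.LowPrec.Opt

open Literature.ComputerArithmetic.JeannerodRump2018
open Literature.ComputerArithmetic.JeannerodRump2018.SumTree
open Cone

/-- Every row of `coneRowsQ4` has a passing certificate tree. -/
theorem coneRowsQ4_covered : RowsCovered 4 coneRowsQ4 conePartsQ4 61 := by
  have c0 : RowsCovered 4 coneRowsQ4 conePartsQ4 0 := rowsCovered_zero _ _ _
  have c1 : RowsCovered 4 coneRowsQ4 conePartsQ4 33 := c0.extend coneCertQ4A_check
  have c2 : RowsCovered 4 coneRowsQ4 conePartsQ4 51 := c1.extend coneCertQ4B_check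
  have c3 : RowsCovered 4 coneRowsQ4 conePartsQ4 61 := c2.extend coneCertQ4C_check
  exact c3

/-- The routing table of every summation tree lies in the cone of `coneRowsQ4`. -/
theorem tab_inCone_q4 (t : SumTree) : InCone coneRowsQ4 (tab 4 t) :=
  tab_inCone (by norm_num) conePartsQ4_valid (coneRowsQ4_covered.all coneRowsQ4_length) t

/-- **opt's TWO-TREE INEQUALITY AT q = 4** (part 8l `TT`), by the cone-closure certificate. -/
theorem TT_four : TT 4 := TT_of_checks coneRowsQ4_tt tab_inCone_q4

/-- **THE ROUTING CONJECTURE `W = BR` FOR EVERY SHAPE AT q = 4** (part 8e `RoutingBound`). -/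
theorem routingBound_q4 (s : Shape) : RoutingBound 4 s :=
  routingBound_of_TT (by norm_num) TT_four s

/-- **CONJECTURE D FOR EVERY SUMMATION TREE AT PRECISION q = 4** (OPTIMA T8(b)(iii)): for every
`p ≥ 1`, any nearest roundings `fl` into `F(4, emin)` and `flp` into `F(p, emin)`, and every summation
tree `t` of nonnegative `F(4, emin)` data, `s ≤ Q_t(u_4, u_p) · fl_p(ŝ)`. -/
theorem conjectureD_q4 {p : ℕ} (hp : 1 ≤ p) {emin : ℤ} {fl flp : ℚ → ℚ} (hfl : IsRoundNearest 4 emin fl)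
    (hflp : IsRoundNearest p emin flp) (t : SumTree) (ht : ∀ x ∈ leaves t, IsFloat 4 emin x ∧ 0 ≤ x) :
    exact t ≤ treeQf (unitRoundoff 4) t (unitRoundoff p) * flp (eval fl t) :=
  conjectureD_of_TT hp (by norm_num) TT_four hfl hflp t ht

end Summit.Ventures.CertifiedArithmetic.LowPrec.Opt
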